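import Summits.CriticalPhenomena.PercolationContinuityZ3.Theorems.Transplant.FKConnectivityAllQAntipodalAnd4SeriesMain
import Summits.CriticalPhenomena.PercolationContinuityZ3.Theorems.Transplant.FKConnectivityAllQAntipodalMinorUpc
import HarnessLib

/-!
# Connectivity correlation inequalities for `φ_{w,q}`, every `q > 0` — file 29a: the CONTRACTED BRIDGE and the `bc`-CONTRACTED AND-drift
# of the 3-edge path `S = {ab, bc, cd}` on every two-terminal series–parallel network between `b, c`

Support file (`--supports stmt-CriticalPhenomena-4575`), FK sub-lane `prim-bschramm-fk-2` (gen 19) of the post-continuity programme; builds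
on p205010 (kernel theorem, internal audit signed; external expert review pending).  No definitions, no named facts, no sorries; standard axioms.

The R-extension theorem of file 29 (`FK.and4_theta_nonpos`) needs, besides the AND-drift of `S` on the inner network `M`, its
`bc`-CONTRACTED AND-drift `∑_{γ ⊆ M} (q^{k(γ∪S) + k((M\γ)∪bc)} - q^{k((M\γ)∪S) + k(γ∪bc)}) h(γ)` (the |W| = 3 AND of `{a, b = c, d}` on the
minor `M/bc`).  This file supplies:
* `FK.apPsiC_andInd_eq` — the CONTRACTED BRIDGE: for `S'` disjoint from `N` and from the contracted set `C`, and `g` not reading `S'`,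
  `apPsiC q (N ∪ S') C 1_{S' ⊆ ·} g = 2 · ∑_{γ ⊆ N} (q^{k(γ∪S'∪C) + k((N\γ)∪C)} - q^{k((N\γ)∪S'∪C) + k(γ∪C)}) g(γ ∪ C)` (any `S' ≠ ∅`) —
  the companion of file 27a's `apPsi_andInd_eq` for gen 11's contracted covariance form `apPsiC`;
* **`FK.andc_side_nonpos`** — for EVERY two-terminal series–parallel `K = N ∪ {ab, cd}` between `b, c` (`ab ≠ cd`, `bc ∉ K`) and every `h`
  monotone on the subsets of `N`, `0 < q ≤ 1`: the `bc`-contracted AND-drift of `S` on `N` is `≤ 0`.  It is half the contracted form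
  `apPsiC q K {bc} (1_{ab} 1_{cd}) ·`, which splits into two contracted one-edge forms (`apPsiC_two_edges_eq`), each `≤ 0` by gen 11's
  `apPsiC_edge_nonpos_of_isTTSP` inside the completed graph `K ∪ {bc}` — TTSP between the ends of EACH of its edges by Duffin's lemma
  (`IsTTSP.insert_edge_of_mem`).  No induction on `K` is needed, which is what lets the R-extension theorem close the induction of file 30a.
[cite: Grimmett2006, §1.4 eq. (1.20) (p. 15); §3.8 Thm. (3.90) (pp. 61–62); §3.9 (pp. 63–64)] [cite: Wagner2006, Thm. 5.8(d), §5.3]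
-/

noncomputable section

namespace Summit.CriticalPhenomena.PercolationContinuityZ3.Theorems

namespace FK

open SimpleGraph Literature.Probability.LatticeModels Literature.Probability.Percolation
open scoped Classical

variable {V : Type*} [Fintype V]

/-! ### The contracted bridge -/

section Bridge

/-- **Contracted bridge.**  For `S` nonempty, disjoint from `N` and from the contracted set `C`, and `g` not reading `S`:
`apPsiC q (N ∪ S) C 1_{S ⊆ ·} g = 2 · ∑_{γ ⊆ N} (q^{k(γ∪S∪C)+k((N\γ)∪C)} - q^{k((N\γ)∪S∪C)+k(γ∪C)}) g(γ ∪ C)` — the AND-drift of `S` on the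
minor `N/C`, doubled. [cite: Grimmett2006, §1.4 eq. (1.20) (p. 15); §3.8 (pp. 61–62)] -/
theorem apPsiC_andInd_eq (q : ℝ) {N S C : Finset (Sym2 V)} (hNS : Disjoint N S) (hS : S.Nonempty) (hSC : Disjoint S C)
    {g : Finset (Sym2 V) → ℝ} (hg : ∀ A T : Finset (Sym2 V), T ⊆ S → g (A ∪ T) = g A) :
    apPsiC q (N ∪ S) C (fun A => if S ⊆ A then 1 else 0) g =
      2 * ∑ γ ∈ N.powerset, (q ^ (clusterCount (↑(γ ∪ S ∪ C) : BondConfig V) ∅ + clusterCount (↑(N \ γ ∪ C) : BondConfig V) ∅) -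
        q ^ (clusterCount (↑(N \ γ ∪ S ∪ C) : BondConfig V) ∅ + clusterCount (↑(γ ∪ C) : BondConfig V) ∅)) * g (γ ∪ C) := by
  unfold apPsiC
  rw [sum_powerset_union_disj hNS]
  have hS0 : S ≠ ∅ := Finset.nonempty_iff_ne_empty.1 hS
  -- `S` is not covered by anything disjoint from it
  have hSsub : ∀ X : Finset (Sym2 V), Disjoint X S → ¬ S ⊆ X ∪ C := by
    intro X hX h
    obtain ⟨e, he⟩ := hS
    rcases Finset.mem_union.1 (h he) with h' | h'
    · exact Finset.disjoint_right.1 hX he h'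
    · exact Finset.disjoint_left.1 hSC he h'
  -- the inner sum over `ε ⊆ S` has exactly two nonzero terms, `ε = S` and `ε = ∅`
  have inner : ∀ γ ∈ N.powerset,
      ∑ ε ∈ S.powerset, q ^ apExpC (N ∪ S) C (γ ∪ ε) *
          (((if S ⊆ γ ∪ ε ∪ C then (1 : ℝ) else 0) - (if S ⊆ (N ∪ S) \ (γ ∪ ε) ∪ C then 1 else 0)) *
            (g (γ ∪ ε ∪ C) - g ((N ∪ S) \ (γ ∪ ε) ∪ C))) =
        (q ^ (clusterCount (↑(γ ∪ S ∪ C) : BondConfig V) ∅ + clusterCount (↑(N \ γ ∪ C) : BondConfig V) ∅) -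
            q ^ (clusterCount (↑(N \ γ ∪ S ∪ C) : BondConfig V) ∅ + clusterCount (↑(γ ∪ C) : BondConfig V) ∅)) *
          (g (γ ∪ C) - g (N \ γ ∪ C)) := by
    intro γ hγ
    rw [Finset.mem_powerset] at hγ
    have hγS : Disjoint γ S := Finset.disjoint_of_subset_left hγ hNS
    have hcS : Disjoint (N \ γ) S := Finset.disjoint_of_subset_left Finset.sdiff_subset hNS
    rw [Finset.sum_eq_add_of_mem S ∅ (Finset.mem_powerset.2 le_rfl) (Finset.mem_powerset.2 (Finset.empty_subset _)) hS0 ?_]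
    · -- the two surviving terms
      simp only [Finset.union_empty]
      have c1 : (N ∪ S) \ (γ ∪ S) = N \ γ := by
        rw [union_sdiff_union hNS hγ le_rfl, sdiff_self, Finset.bot_eq_empty, Finset.union_empty]
      have c2 : (N ∪ S) \ γ = N \ γ ∪ S := by
        rw [Finset.union_sdiff_distrib, hγS.symm.sdiff_eq_left]
      have t1 : S ⊆ γ ∪ S ∪ C := fun e he => Finset.mem_union_left _ (Finset.mem_union_right _ he)
      have t2 : ¬ S ⊆ N \ γ ∪ C := hSsub _ hcS
      have t3 : ¬ S ⊆ γ ∪ C := hSsub _ hγS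
      have t4 : S ⊆ N \ γ ∪ S ∪ C := fun e he => Finset.mem_union_left _ (Finset.mem_union_right _ he)
      have g1 : g (γ ∪ S ∪ C) = g (γ ∪ C) := by rw [Finset.union_right_comm, hg _ S le_rfl]
      have g2 : g (N \ γ ∪ S ∪ C) = g (N \ γ ∪ C) := by rw [Finset.union_right_comm, hg _ S le_rfl]
      rw [c1, c2, if_pos t1, if_neg t2, if_neg t3, if_pos t4, g1, g2]
      unfold apExpC
      rw [c1, c2]
      ring
    · -- the other terms vanish
      intro ε hε hne
      rw [Finset.mem_powerset] at hε
      have n1 : ¬ S ⊆ γ ∪ ε ∪ C := fun h => hne.1 (le_antisymm hε fun e he => by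
        rcases Finset.mem_union.1 (h he) with h' | h'
        · rcases Finset.mem_union.1 h' with h'' | h''
          · exact (Finset.disjoint_left.1 hγS h'' he).elim
          · exact h''
        · exact (Finset.disjoint_left.1 hSC he h').elim)
      have n2 : ¬ S ⊆ (N ∪ S) \ (γ ∪ ε) ∪ C := fun h => hne.2 (Finset.eq_empty_of_forall_notMem fun e he => by
        rcases Finset.mem_union.1 (h (hε he)) with h' | h'
        · exact (Finset.mem_sdiff.1 h').2 (Finset.mem_union_right _ he)
        · exact Finset.disjoint_left.1 hSC (hε he) h')
      rw [if_neg n1, if_neg n2, sub_self, zero_mul, mul_zero]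
  rw [Finset.sum_congr rfl inner]
  -- symmetrise: the `g(N \ γ ∪ C)` half is the `g(γ ∪ C)` half after `γ ↦ N \ γ`
  have flip := sum_powerset_flip N (fun γ =>
    (q ^ (clusterCount (↑(γ ∪ S ∪ C) : BondConfig V) ∅ + clusterCount (↑(N \ γ ∪ C) : BondConfig V) ∅) -
        q ^ (clusterCount (↑(N \ γ ∪ S ∪ C) : BondConfig V) ∅ + clusterCount (↑(γ ∪ C) : BondConfig V) ∅)) * g (N \ γ ∪ C))
  have flip' : ∑ γ ∈ N.powerset, (q ^ (clusterCount (↑(γ ∪ S ∪ C) : BondConfig V) ∅ + clusterCount (↑(N \ γ ∪ C) : BondConfig V) ∅) -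
        q ^ (clusterCount (↑(N \ γ ∪ S ∪ C) : BondConfig V) ∅ + clusterCount (↑(γ ∪ C) : BondConfig V) ∅)) * g (N \ γ ∪ C) =
      - ∑ γ ∈ N.powerset, (q ^ (clusterCount (↑(γ ∪ S ∪ C) : BondConfig V) ∅ + clusterCount (↑(N \ γ ∪ C) : BondConfig V) ∅) -
        q ^ (clusterCount (↑(N \ γ ∪ S ∪ C) : BondConfig V) ∅ + clusterCount (↑(γ ∪ C) : BondConfig V) ∅)) * g (γ ∪ C) := by
    rw [flip, ← Finset.sum_neg_distrib]
    refine Finset.sum_congr rfl fun γ hγ => ?_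
    rw [Finset.mem_powerset] at hγ
    rw [Finset.sdiff_sdiff_eq_self hγ]
    ring
  have split : ∑ γ ∈ N.powerset, (q ^ (clusterCount (↑(γ ∪ S ∪ C) : BondConfig V) ∅ + clusterCount (↑(N \ γ ∪ C) : BondConfig V) ∅) -
        q ^ (clusterCount (↑(N \ γ ∪ S ∪ C) : BondConfig V) ∅ + clusterCount (↑(γ ∪ C) : BondConfig V) ∅)) *
          (g (γ ∪ C) - g (N \ γ ∪ C)) =
      ∑ γ ∈ N.powerset, (q ^ (clusterCount (↑(γ ∪ S ∪ C) : BondConfig V) ∅ + clusterCount (↑(N \ γ ∪ C) : BondConfig V) ∅) -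
        q ^ (clusterCount (↑(N \ γ ∪ S ∪ C) : BondConfig V) ∅ + clusterCount (↑(γ ∪ C) : BondConfig V) ∅)) * g (γ ∪ C) -
        ∑ γ ∈ N.powerset, (q ^ (clusterCount (↑(γ ∪ S ∪ C) : BondConfig V) ∅ + clusterCount (↑(N \ γ ∪ C) : BondConfig V) ∅) -
        q ^ (clusterCount (↑(N \ γ ∪ S ∪ C) : BondConfig V) ∅ + clusterCount (↑(γ ∪ C) : BondConfig V) ∅)) * g (N \ γ ∪ C) := by
    rw [← Finset.sum_sub_distrib]; refine Finset.sum_congr rfl fun γ _ => ?_; ring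
  rw [split, flip']
  ring

end Bridge

/-! ### The contracted side input -/

section Sides

variable {a b c d : V}

omit [Fintype V] in
/-- Finset bookkeeping: `X ∪ {ab, cd} ∪ {bc} = X ∪ {ab, bc, cd}`. [folklore] -/
theorem union_pair_union_singleton_eq (X : Finset (Sym2 V)) (a b c d : V) :
    X ∪ {s(a, b), s(c, d)} ∪ {s(b, c)} = X ∪ {s(a, b), s(b, c), s(c, d)} := by
  ext e
  simp only [Finset.mem_union, Finset.mem_insert, Finset.mem_singleton]
  tauto

omit [Fintype V] in
/-- Finset bookkeeping: `(A ∪ {x}) ∪ (B ∪ {y}) = (A ∪ B) ∪ {x, y}` as insertions. [folklore] -/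
theorem insert_union_insert_eq (A B : Finset (Sym2 V)) (x y : Sym2 V) :
    insert x A ∪ insert y B = insert x (insert y (A ∪ B)) := by
  ext e
  simp only [Finset.mem_union, Finset.mem_insert]
  tauto

/-- **The `bc`-contracted AND-drift of `S = {ab, bc, cd}` is `≤ 0` on every two-terminal series–parallel network between `b, c` through the
end edges.**  Let `K = N ∪ {ab, cd}` be TTSP between `b` and `c` with `ab, cd ∉ N` distinct and `bc ∉ K`.  Then for every `h` monotone on the
subsets of `N` and `0 < q ≤ 1`: `∑_{γ ⊆ N} (q^{k(γ∪S) + k((N\γ)∪bc)} - q^{k((N\γ)∪S) + k(γ∪bc)}) h(γ) ≤ 0` — the |W| = 3 AND of `{a, b = c, d}` on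
the minor `K/bc`: it is half the contracted covariance form `apPsiC q K {bc} (1_{ab} 1_{cd}) ·` (the contracted bridge with `S' = {ab, cd}`,
`C = {bc}`), which splits into two contracted one-edge forms (`apPsiC_two_edges_eq`), each `≤ 0` by gen 11's `apPsiC_edge_nonpos_of_isTTSP`
inside the completed graph `K ∪ {bc}` — TTSP between the ends of EACH of its edges (`IsTTSP.insert_edge_of_mem`, Duffin).
[cite: Grimmett2006, §3.9 (pp. 63–64)] [cite: Wagner2006, Thm. 5.8(d), §5.3] -/
theorem andc_side_nonpos {q : ℝ} (hq0 : 0 < q) (hq1 : q ≤ 1) {N : Finset (Sym2 V)}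
    (hK : IsTTSP (insert s(a, b) (insert s(c, d) N)) b c) (habN : s(a, b) ∉ N) (hcdN : s(c, d) ∉ N)
    (habcd : s(a, b) ≠ s(c, d)) (hbcK : s(b, c) ∉ insert s(a, b) (insert s(c, d) N))
    {h : Finset (Sym2 V) → ℝ} (hmono : ∀ ⦃A B : Finset (Sym2 V)⦄, A ⊆ B → B ⊆ N → h A ≤ h B) :
    ∑ γ ∈ N.powerset,
        (q ^ (clusterCount (↑(γ ∪ {s(a, b), s(b, c), s(c, d)}) : BondConfig V) ∅ +
              clusterCount (↑(N \ γ ∪ {s(b, c)}) : BondConfig V) ∅) -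
          q ^ (clusterCount (↑(N \ γ ∪ {s(a, b), s(b, c), s(c, d)}) : BondConfig V) ∅ +
              clusterCount (↑(γ ∪ {s(b, c)}) : BondConfig V) ∅)) * h γ ≤ 0 := by
  -- the completed graph is TTSP between the ends of each end edge (Duffin)
  have hHab : IsTTSP (insert s(b, c) (insert s(a, b) (insert s(c, d) N))) a b :=
    hK.insert_edge_of_mem (Finset.mem_insert_of_mem (Finset.mem_insert_self _ _))
  have hHcd : IsTTSP (insert s(b, c) (insert s(a, b) (insert s(c, d) N))) c d :=
    hK.insert_edge_of_mem (Finset.mem_insert_of_mem (Finset.mem_insert_of_mem (Finset.mem_insert_self _ _)))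
  -- where the edges are
  have hbcN : s(b, c) ∉ N := fun hh => hbcK (Finset.mem_insert_of_mem (Finset.mem_insert_of_mem hh))
  have habC : s(a, b) ∉ ({s(b, c)} : Finset (Sym2 V)) := by
    rw [Finset.mem_singleton]; intro hh; exact hbcK (hh ▸ Finset.mem_insert_self _ _)
  have hcdC : s(c, d) ∉ ({s(b, c)} : Finset (Sym2 V)) := by
    rw [Finset.mem_singleton]; intro hh
    exact hbcK (hh ▸ Finset.mem_insert_of_mem (Finset.mem_insert_self _ _))
  have habMx : s(a, b) ∉ insert s(c, d) N := by
    rw [Finset.mem_insert, not_or]; exact ⟨habcd, habN⟩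
  have hcdMy : s(c, d) ∉ insert s(a, b) N := by
    rw [Finset.mem_insert, not_or]; exact ⟨fun hh => habcd hh.symm, hcdN⟩
  have hM₁ : insert s(c, d) N ⊆ insert s(b, c) (insert s(a, b) (insert s(c, d) N)) :=
    (Finset.subset_insert _ _).trans (Finset.subset_insert _ _)
  have hM₂ : insert s(a, b) N ⊆ insert s(b, c) (insert s(a, b) (insert s(c, d) N)) :=
    (Finset.insert_subset_insert _ (Finset.subset_insert _ _)).trans (Finset.subset_insert _ _)
  have hC : ({s(b, c)} : Finset (Sym2 V)) ⊆ insert s(b, c) (insert s(a, b) (insert s(c, d) N)) :=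
    Finset.singleton_subset_iff.2 (Finset.mem_insert_self _ _)
  -- the extended test function
  set G : Finset (Sym2 V) → ℝ := fun X => h (X ∩ N) with hG
  have hGmono : ∀ ⦃A B : Finset (Sym2 V)⦄, A ⊆ B → G A ≤ G B := fun A B hAB =>
    hmono (Finset.inter_subset_inter hAB le_rfl) Finset.inter_subset_right
  have hGab : ∀ A : Finset (Sym2 V), G (insert s(a, b) A) = G A := fun A => by
    simp only [hG, Finset.insert_inter_of_notMem habN]
  have hGcd : ∀ A : Finset (Sym2 V), G (insert s(c, d) A) = G A := fun A => by
    simp only [hG, Finset.insert_inter_of_notMem hcdN]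
  -- the two contracted one-edge forms
  have hx : apPsiC q (insert s(a, b) (insert s(c, d) N)) {s(b, c)} (fun A => if s(a, b) ∈ A then 1 else 0) G ≤ 0 :=
    apPsiC_edge_nonpos_of_isTTSP hq0 hq1 hHab hM₁ hC habMx habC hGab fun A B hAB _ => hGmono hAB
  have hy : apPsiC q (insert s(a, b) (insert s(c, d) N)) {s(b, c)} (fun A => if s(c, d) ∈ A then 1 else 0) G ≤ 0 := by
    rw [Finset.insert_comm]
    exact apPsiC_edge_nonpos_of_isTTSP hq0 hq1 hHcd hM₂ hC hcdMy hcdC hGcd fun A B hAB _ => hGmono hAB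
  have h2 := apPsiC_two_edges_eq q (E := insert s(a, b) (insert s(c, d) N)) (C := {s(b, c)})
    (Finset.mem_insert_self _ _) (Finset.mem_insert_of_mem (Finset.mem_insert_self _ _)) habC hcdC G
  -- the bridge
  have hNS : Disjoint N ({s(a, b), s(c, d)} : Finset (Sym2 V)) := by
    rw [Finset.disjoint_insert_right, Finset.disjoint_singleton_right]; exact ⟨habN, hcdN⟩
  have hSC : Disjoint ({s(a, b), s(c, d)} : Finset (Sym2 V)) {s(b, c)} := by
    rw [Finset.disjoint_singleton_right, Finset.mem_insert, Finset.mem_singleton, not_or]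
    exact ⟨fun hh => habC (Finset.mem_singleton.2 hh.symm), fun hh => hcdC (Finset.mem_singleton.2 hh.symm)⟩
  have hg' : ∀ A T : Finset (Sym2 V), T ⊆ {s(a, b), s(c, d)} → G (A ∪ T) = G A := by
    intro A T hT
    simp only [hG, Finset.union_inter_distrib_right]
    have : T ∩ N = ∅ := Finset.disjoint_iff_inter_eq_empty.1 (Finset.disjoint_of_subset_left hT hNS.symm)
    rw [this, Finset.union_empty]
  have key := apPsiC_andInd_eq q hNS ⟨s(a, b), Finset.mem_insert_self _ _⟩ hSC hg'
  have hE' : N ∪ {s(a, b), s(c, d)} = insert s(a, b) (insert s(c, d) N) := by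
    rw [union_pair_eq_insert, Finset.insert_comm]
  have hf : (fun A : Finset (Sym2 V) => if ({s(a, b), s(c, d)} : Finset (Sym2 V)) ⊆ A then (1 : ℝ) else 0) =
      fun A => if s(a, b) ∈ A ∧ s(c, d) ∈ A then 1 else 0 := by
    funext A
    simp only [Finset.insert_subset_iff, Finset.singleton_subset_iff]
  rw [hE', hf, h2] at key
  -- identify the target sum with the bridge sum
  have hsum : ∑ γ ∈ N.powerset,
      (q ^ (clusterCount (↑(γ ∪ {s(a, b), s(b, c), s(c, d)}) : BondConfig V) ∅ + clusterCount (↑(N \ γ ∪ {s(b, c)}) : BondConfig V) ∅) -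
        q ^ (clusterCount (↑(N \ γ ∪ {s(a, b), s(b, c), s(c, d)}) : BondConfig V) ∅ + clusterCount (↑(γ ∪ {s(b, c)}) : BondConfig V) ∅)) * h γ =
      ∑ γ ∈ N.powerset,
      (q ^ (clusterCount (↑(γ ∪ {s(a, b), s(c, d)} ∪ {s(b, c)}) : BondConfig V) ∅ + clusterCount (↑(N \ γ ∪ {s(b, c)}) : BondConfig V) ∅) -
        q ^ (clusterCount (↑(N \ γ ∪ {s(a, b), s(c, d)} ∪ {s(b, c)}) : BondConfig V) ∅ + clusterCount (↑(γ ∪ {s(b, c)}) : BondConfig V) ∅)) *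
          G (γ ∪ {s(b, c)}) := by
    refine Finset.sum_congr rfl fun γ hγ => ?_
    rw [Finset.mem_powerset] at hγ
    rw [union_pair_union_singleton_eq, union_pair_union_singleton_eq]
    have hGγ : G (γ ∪ {s(b, c)}) = h γ := by
      simp only [hG, Finset.union_inter_distrib_right, Finset.inter_eq_left.2 hγ,
        Finset.singleton_inter_of_notMem hbcN, Finset.union_empty]
    rw [hGγ]
  rw [hsum]
  linarith

end Sides

end FK

end Summit.CriticalPhenomena.PercolationContinuityZ3.Theorems

end
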